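import Summits.Ventures.CertifiedManyBodySolver.Theorems.TcThermcert1VertexDefs
import HarnessLib

/-!
# Route «hubbard-tc-thermcert-1», crux K2 `TcThermcert1.ThermalStiffnessCeilingBoxb10_le_9o71` (stmt-Ventures-26382), line «vertex»
# (hub-tc-therm-plan-2, registered skeleton 135a6fd895490092): its STUB S3 `stub_lagr_affine : LagrAffineAll` — PROVED

HONEST FRAMING: parameter BOOKKEEPING only — the frozen-dual Lagrangian of a `(U, μ₀)`-cell certificate is jointly affine in `(U, μ₀)`;
nothing about the Hubbard model is proved (no certificate: S4 `VertexCoverBoxB10` is the crux content and stays open; no number, no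
`T_c`); KT ceilings never assert superconductivity; NO lower bound on `T_c` is claimed; no summit, rung or crux statement is proved here.

The proof is hub-tc-therm-plan-2's S3 kit (`line-vertex.s3kit.lean` sha16 798cc13f9ea7b5b6 §6–§7, farm rc 0, attached as evidence on
stmt-Ventures-26382 2026-08-28T07:17Z), VERBATIM over the tree objects of `Theorems/TcThermcert1Defs.lean` (hubbard-thermal-p4, p614173:
`hamCommLocal`, `doubleCommDensity`, `trialWord`) and `Theorems/TcThermcert1VertexDefs.lean` (`stWord`, `eebWord`, `bogWord`, `CertDatum`,
`CertDatum.lagr`, `CertDatum.LagrAffine`, `LagrAffineAll`); landed by seat `hubbard-tc-p1` (g28) on the cell lead's HANDOFF item and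
RULING R128 (3) («plan-2's PROVED S3 … may be landed by any prover `--supports stmt-Ventures-26382`»). Why S3 holds: the grand-canonical
local Hamiltonian `K_Λ(1, t′, U, μ, 0) = H₀ + U·D − μ·N` enters every row word exactly ONCE and the objective `W_a(U)` once through
`h_a = [H_{Λ}(U), Γa]` (`gcLocalHamiltonianTT'_eq`; `hubbardTTPrimeFermionInteraction_add/_smul` make the `t–t′–U` interaction affine in
`U`); `commDensity` and matrix products are ℂ-linear in the one parameter-carrying factor, `ω.expect Λ′` is a ℂ-linear map, `re` is
ℝ-linear, and the finite `List.sum`s of `CertDatum.lagr` commute with affine combinations.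

## Contents (everything PROVED)

* §1 `localHamiltonian_ttU_affine`, `gcLocalHamiltonianTT'_affine` — the local `t–t′–U` Hamiltonian is affine in `U`, the local GC
  Hamiltonian jointly affine in `(U, μ)`.
* §2 `commDensity_add_right ∕ _smul_right ∕ _affine_right` (ℂ-linearity of the commutator density in its right argument) and the
  per-word affinity lemmas `hamCommLocal_affine`, `doubleCommDensity_affine`, `trialWord_affine`, `stWord_affine`, `eebWord_affine`,
  `bogWord_affine` along arbitrary lines of the `(U, μ₀)`-plane.
* §3 `CertDatum.lagrAffine (d) : d.LagrAffine`, `lagrAffineAll_proved : LagrAffineAll`, and the REGISTERED STUB by name and signature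
  **`stub_lagr_affine : LagrAffineAll`**.

References: XuEtAl2024 eq. (1); BratteliRobinsonII1997 Thm. 6.2.4; DLS1978 §2 eqs. (27), (28); WangEtAl2024 §III.
-/

noncomputable section

namespace Summit.Ventures.CertifiedManyBodySolver.Theorems.TcThermcert1.Vertex

open Filter Topology Matrix Finset
open Literature.MathematicalPhysics.QuantumLattice
open Literature.MathematicalPhysics.QuantumLattice.ThermodynamicLimit
open Literature.MathematicalPhysics.QuantumFieldTheory
open Literature.MathematicalPhysics.StatisticalMechanics
open Literature.Probability.LatticeModels
open Summit.Ventures.CertifiedManyBodySolver.Observables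
open Summit.Ventures.CertifiedManyBodySolver.Theorems.TcThermcert1
open scoped ComplexConjugate ComplexOrder

/-! ## §1 The local Hamiltonians are affine in the couplings (kit §6) -/

/-- The local `t–t′–U` Hamiltonian (free boundary, `t = 1`, fixed `t′`) is affine in `U`:
`H_Λ((1−θ)U₁ + θU₂) = (1−θ)·H_Λ(U₁) + θ·H_Λ(U₂)`. [cite: BratteliRobinsonII1997, Thm. 6.2.4] -/
theorem localHamiltonian_ttU_affine (tp U₁ U₂ θ : ℝ) (Λ : Finset (Site 2)) :
    (hubbardTTPrimeFermionInteraction 1 tp ((1 - θ) * U₁ + θ * U₂)).localHamiltonian Λ =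
      (((1 - θ : ℝ)) : ℂ) • (hubbardTTPrimeFermionInteraction 1 tp U₁).localHamiltonian Λ +
        ((θ : ℝ) : ℂ) • (hubbardTTPrimeFermionInteraction 1 tp U₂).localHamiltonian Λ := by
  have hΦ : ∀ X : Finset (Site 2), (hubbardTTPrimeFermionInteraction 1 tp ((1 - θ) * U₁ + θ * U₂)).Φ X =
      (((1 - θ : ℝ)) : ℂ) • (hubbardTTPrimeFermionInteraction 1 tp U₁).Φ X +
        ((θ : ℝ) : ℂ) • (hubbardTTPrimeFermionInteraction 1 tp U₂).Φ X := by
    intro X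
    have h1 : hubbardTTPrimeFermionInteraction 1 tp ((1 - θ) * U₁ + θ * U₂) =
        hubbardTTPrimeFermionInteraction ((1 - θ) * 1 + θ * 1) ((1 - θ) * tp + θ * tp) ((1 - θ) * U₁ + θ * U₂) := by
      congr 1 <;> ring
    rw [h1, hubbardTTPrimeFermionInteraction_add, hubbardTTPrimeFermionInteraction_smul, hubbardTTPrimeFermionInteraction_smul]
  unfold FermionInteraction.localHamiltonian
  simp_rw [hΦ, map_add, map_smul, Finset.sum_add_distrib, Finset.smul_sum]

/-- The local grand-canonical Hamiltonian `K_Λ(1, t′, U, μ, 0) = H_Λ(U) − μ·N_Λ` is jointly affine in `(U, μ)`.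
[cite: BratteliRobinsonII1997, Thm. 6.2.4] -/
theorem gcLocalHamiltonianTT'_affine (Λ : Finset (Site 2)) (tp U₁ U₂ μ₁ μ₂ θ : ℝ) :
    gcLocalHamiltonianTT' Λ 1 tp ((1 - θ) * U₁ + θ * U₂) ((1 - θ) * μ₁ + θ * μ₂) 0 =
      (((1 - θ : ℝ)) : ℂ) • gcLocalHamiltonianTT' Λ 1 tp U₁ μ₁ 0 + ((θ : ℝ) : ℂ) • gcLocalHamiltonianTT' Λ 1 tp U₂ μ₂ 0 := by
  simp only [gcLocalHamiltonianTT'_eq, localHamiltonian_ttU_affine tp U₁ U₂ θ Λ]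
  push_cast
  simp only [zero_smul, sub_zero, smul_sub, smul_smul]
  module

/-! ## §2 Linearity of the commutator density in its right argument; the per-word affinity lemmas (kit §7) -/

section CommDensity
variable {d : ℕ}

/-- `commDensity` is additive in its right argument: `Σ_z [τ_z A, C₁ + C₂] = Σ_z [τ_z A, C₁] + Σ_z [τ_z A, C₂]`.
[cite: BratteliRobinsonII1997, Thm. 6.2.4] -/
theorem commDensity_add_right (Ω Z : Finset (Site d)) {ΛA ΛC : Finset (Site d)} (hC : ΛC ⊆ Ω)
    (A : FermionOp ΛA) (C₁ C₂ : FermionOp ΛC) :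
    commDensity Ω Z hC A (C₁ + C₂) = commDensity Ω Z hC A C₁ + commDensity Ω Z hC A C₂ := by
  unfold commDensity
  rw [← Finset.sum_add_distrib]
  refine Finset.sum_congr rfl fun z _ => ?_
  rw [map_add, mul_add, add_mul]
  abel

/-- `commDensity` commutes with scalars in its right argument. [cite: BratteliRobinsonII1997, Thm. 6.2.4] -/
theorem commDensity_smul_right (Ω Z : Finset (Site d)) {ΛA ΛC : Finset (Site d)} (hC : ΛC ⊆ Ω)
    (A : FermionOp ΛA) (c : ℂ) (C : FermionOp ΛC) :
    commDensity Ω Z hC A (c • C) = c • commDensity Ω Z hC A C := by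
  unfold commDensity
  rw [Finset.smul_sum]
  refine Finset.sum_congr rfl fun z _ => ?_
  rw [map_smul, Matrix.mul_smul, Matrix.smul_mul, smul_sub]

/-- `commDensity` preserves affine combinations in its right argument. [cite: BratteliRobinsonII1997, Thm. 6.2.4] -/
theorem commDensity_affine_right (Ω Z : Finset (Site d)) {ΛA ΛC : Finset (Site d)} (hC : ΛC ⊆ Ω)
    (A : FermionOp ΛA) (θ : ℝ) (C₁ C₂ : FermionOp ΛC) :
    commDensity Ω Z hC A ((((1 - θ : ℝ)) : ℂ) • C₁ + ((θ : ℝ) : ℂ) • C₂) =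
      (((1 - θ : ℝ)) : ℂ) • commDensity Ω Z hC A C₁ + ((θ : ℝ) : ℂ) • commDensity Ω Z hC A C₂ := by
  rw [commDensity_add_right, commDensity_smul_right, commDensity_smul_right]

end CommDensity

/-- `h_a(U) = [H_{[-(r+1),r+1]²}(U), Γa]` is affine in `U`. [cite: DLS1978, §2 eq. (28)] -/
theorem hamCommLocal_affine (tp U₁ U₂ θ : ℝ) (r : ℕ) (a : FermionOp (box 2 r)) :
    hamCommLocal tp ((1 - θ) * U₁ + θ * U₂) r a =
      (((1 - θ : ℝ)) : ℂ) • hamCommLocal tp U₁ r a + ((θ : ℝ) : ℂ) • hamCommLocal tp U₂ r a := by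
  unfold hamCommLocal
  rw [localHamiltonian_ttU_affine]
  simp only [add_mul, mul_add, Matrix.smul_mul, Matrix.mul_smul, smul_sub]
  abel

/-- `m_a(U) = Σ_z [τ_z a, h_a(U)]` is affine in `U`. [cite: DLS1978, §2 eq. (28)] -/
theorem doubleCommDensity_affine (tp U₁ U₂ θ : ℝ) (r : ℕ) (a : FermionOp (box 2 r)) :
    doubleCommDensity tp ((1 - θ) * U₁ + θ * U₂) r a =
      (((1 - θ : ℝ)) : ℂ) • doubleCommDensity tp U₁ r a + ((θ : ℝ) : ℂ) • doubleCommDensity tp U₂ r a := by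
  unfold doubleCommDensity
  rw [hamCommLocal_affine, commDensity_affine_right]

/-- The trial-generator word `W_a(U) = ½Γk₀ + i·Γd_a + ½m_a(U)` is affine in `U` (only `m_a` carries `U`).
[cite: DLS1978, §2 eqs. (27), (28)] -/
theorem trialWord_affine (tp U₁ U₂ θ : ℝ) (r : ℕ) (a : FermionOp (box 2 r)) :
    trialWord tp ((1 - θ) * U₁ + θ * U₂) r a =
      (((1 - θ : ℝ)) : ℂ) • trialWord tp U₁ r a + ((θ : ℝ) : ℂ) • trialWord tp U₂ r a := by
  unfold trialWord
  rw [doubleCommDensity_affine]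
  push_cast
  module

/-- The GC stationarity word `K(U,μ₀)Â − ÂK(U,μ₀)` is jointly affine in `(U, μ₀)`. [cite: BratteliRobinsonII1997, Thm. 6.2.4] -/
theorem stWord_affine (tp U₁ U₂ μ₁ μ₂ θ : ℝ) {Λ Λ' : Finset (Site 2)} (hΛ : Λ ⊆ Λ') (A : FermionOp Λ) :
    stWord tp ((1 - θ) * U₁ + θ * U₂) ((1 - θ) * μ₁ + θ * μ₂) hΛ A =
      (((1 - θ : ℝ)) : ℂ) • stWord tp U₁ μ₁ hΛ A + ((θ : ℝ) : ℂ) • stWord tp U₂ μ₂ hΛ A := by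
  unfold stWord
  rw [gcLocalHamiltonianTT'_affine]
  simp only [add_mul, mul_add, Matrix.smul_mul, Matrix.mul_smul, smul_sub]
  abel

/-- The `(s,q)`-linearised energy–entropy-balance word is jointly affine in `(U, μ₀)` (its `s`, `q` parts are parameter-free).
[cite: FawziFawziScalet2024, Thm. 3.1] -/
theorem eebWord_affine (β tp U₁ U₂ μ₁ μ₂ θ : ℝ) {Λ Λ' : Finset (Site 2)} (hΛ : Λ ⊆ Λ') (A : FermionOp Λ) (s q : ℝ) :
    eebWord β tp ((1 - θ) * U₁ + θ * U₂) ((1 - θ) * μ₁ + θ * μ₂) hΛ A s q =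
      (((1 - θ : ℝ)) : ℂ) • eebWord β tp U₁ μ₁ hΛ A s q + ((θ : ℝ) : ℂ) • eebWord β tp U₂ μ₂ hΛ A s q := by
  unfold eebWord
  rw [gcLocalHamiltonianTT'_affine]
  simp only [add_mul, mul_add, mul_sub, Matrix.smul_mul, Matrix.mul_smul, smul_sub, smul_add, smul_smul]
  push_cast
  module

/-- The canonical Bogoliubov word is affine in `U` (it does not see `μ₀`). [cite: DLS1978, §2 eq. (28)] -/
theorem bogWord_affine (β tp U₁ U₂ θ : ℝ) {Λ Λ' : Finset (Site 2)} (hΛ : Λ ⊆ Λ') (A C : FermionOp Λ) :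
    bogWord β tp ((1 - θ) * U₁ + θ * U₂) hΛ A C =
      (((1 - θ : ℝ)) : ℂ) • bogWord β tp U₁ hΛ A C + ((θ : ℝ) : ℂ) • bogWord β tp U₂ hΛ A C := by
  unfold bogWord
  rw [localHamiltonian_ttU_affine]
  simp only [add_mul, mul_add, Matrix.smul_mul, Matrix.mul_smul, smul_sub, smul_add, smul_smul, sub_mul, mul_sub]
  push_cast
  module

/-! ## §3 S3 assembled: push `ω.expect Λ′` (ℂ-linear) and `re` through the word affinity lemmas, then `List.sum` algebra -/

/-- `re` of a real-affine combination of complex numbers. [folklore] -/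
private theorem re_affine (X Y : ℂ) (a b : ℝ) : ((a : ℂ) * X + (b : ℂ) * Y).re = a * X.re + b * Y.re := by
  simp only [Complex.add_re, Complex.re_ofReal_mul]

/-- `re` of a complex multiple of a real-affine combination. [folklore] -/
private theorem re_mul_affine (y X Y : ℂ) (a b : ℝ) :
    (y * ((a : ℂ) * X + (b : ℂ) * Y)).re = a * (y * X).re + b * (y * Y).re := by
  simp only [mul_add, Complex.add_re, Complex.mul_re, Complex.ofReal_re, Complex.ofReal_im, Complex.mul_im]
  ring

/-- A finite `List.sum` commutes with affine combinations of the summands. [folklore] -/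
private theorem list_sum_map_affine {α : Type*} (l : List α) (f g : α → ℝ) (θ : ℝ) :
    (l.map fun x => (1 - θ) * f x + θ * g x).sum = (1 - θ) * (l.map f).sum + θ * (l.map g).sum := by
  rw [List.sum_map_add, List.sum_map_mul_left, List.sum_map_mul_left]

/-- **S3, proved** (hub-tc-therm-plan-2's kit, verbatim): every frozen-dual Lagrangian is jointly affine in `(U, μ₀)` along every
line of the parameter plane. [cite: WangEtAl2024, §III] -/
theorem CertDatum.lagrAffine (d : CertDatum) : d.LagrAffine := by
  intro p₁ p₂ q₁ q₂ θ ω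
  have hW : (ω.expect (box 2 (3 * d.r + 2)) (trialWord 0 ((1 - θ) * p₁ + θ * q₁) d.r d.a)).re =
      (1 - θ) * (ω.expect (box 2 (3 * d.r + 2)) (trialWord 0 p₁ d.r d.a)).re +
        θ * (ω.expect (box 2 (3 * d.r + 2)) (trialWord 0 q₁ d.r d.a)).re := by
    rw [trialWord_affine, map_add, map_smul, map_smul, smul_eq_mul, smul_eq_mul, re_affine]
  have hst : (d.st.map fun ρ => (ρ.y * ω.expect ρ.Λ' (stWord 0 ((1 - θ) * p₁ + θ * q₁) ((1 - θ) * p₂ + θ * q₂) ρ.hΛ ρ.A)).re) =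
      d.st.map fun ρ => (1 - θ) * (ρ.y * ω.expect ρ.Λ' (stWord 0 p₁ p₂ ρ.hΛ ρ.A)).re +
        θ * (ρ.y * ω.expect ρ.Λ' (stWord 0 q₁ q₂ ρ.hΛ ρ.A)).re :=
    List.map_congr_left fun ρ _ => by
      rw [stWord_affine, map_add, map_smul, map_smul, smul_eq_mul, smul_eq_mul, re_mul_affine]
  have heeb : (d.eeb.map fun ρ => ρ.y * (ω.expect ρ.Λ' (eebWord 10 0 ((1 - θ) * p₁ + θ * q₁) ((1 - θ) * p₂ + θ * q₂) ρ.hΛ ρ.A ρ.s ρ.q)).re) =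
      d.eeb.map fun ρ => (1 - θ) * (ρ.y * (ω.expect ρ.Λ' (eebWord 10 0 p₁ p₂ ρ.hΛ ρ.A ρ.s ρ.q)).re) +
        θ * (ρ.y * (ω.expect ρ.Λ' (eebWord 10 0 q₁ q₂ ρ.hΛ ρ.A ρ.s ρ.q)).re) :=
    List.map_congr_left fun ρ _ => by
      rw [eebWord_affine, map_add, map_smul, map_smul, smul_eq_mul, smul_eq_mul, re_affine]; ring
  have hbog : (d.bog.map fun ρ => ρ.y * (ω.expect ρ.Λ' (bogWord 10 0 ((1 - θ) * p₁ + θ * q₁) ρ.hΛ ρ.A ρ.C)).re) =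
      d.bog.map fun ρ => (1 - θ) * (ρ.y * (ω.expect ρ.Λ' (bogWord 10 0 p₁ ρ.hΛ ρ.A ρ.C)).re) +
        θ * (ρ.y * (ω.expect ρ.Λ' (bogWord 10 0 q₁ ρ.hΛ ρ.A ρ.C)).re) :=
    List.map_congr_left fun ρ _ => by
      rw [bogWord_affine, map_add, map_smul, map_smul, smul_eq_mul, smul_eq_mul, re_affine]; ring
  unfold CertDatum.lagr
  rw [hW, hst, heeb, hbog, list_sum_map_affine, list_sum_map_affine, list_sum_map_affine]
  ring

/-- Hence the line's stub statement `LagrAffineAll` holds outright (hub-tc-therm-plan-2's name for it). [cite: WangEtAl2024, §III] -/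
theorem lagrAffineAll_proved : LagrAffineAll := fun d => d.lagrAffine

/-- **STUB S3 of line «vertex» (crux K2, stmt-Ventures-26382), by its registered name and signature**: every frozen-dual Lagrangian is
jointly affine in `(U, μ₀)`. [cite: WangEtAl2024, §III] -/
theorem stub_lagr_affine : LagrAffineAll := lagrAffineAll_proved

end Summit.Ventures.CertifiedManyBodySolver.Theorems.TcThermcert1.Vertex

end
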